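import Mathlib
import Literature.NumberTheory.Automorphic.ToricPseudoEisensteinSeries
import HarnessLib

/-!
# Partition-of-unity unfolding: weighted integrals over `T` are integrals over the quotient `T ⧸ Λ`

Topic `NumberTheory/Automorphic`; namespace `Literature.NumberTheory.Automorphic.TorusUnfold`.

The toric pseudo-Eisenstein series of `ToricPseudoEisensteinSeries` integrate over the torus `T`
against a cut-off `β ∈ C_c(T)` that is a `Λ`-partition of unity (`Σ_{a ∈ Λ} β(t a) = 1`, `Λ ≤ T`
cocompact) precisely so that `β`-weighted integrals over `T` ARE integrals over the compact quotient
`T ⧸ Λ` — Weil's formula `∫_T f dν = ∫_{T/Λ} Σ_{a ∈ Λ} f(t a) dν̄(tΛ)` [DeitmarEchterhoff2014, Thm 1.5.3]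
applied to `f = (g ∘ π) · β`, whose `Λ`-automorphization is `g · 1`. This file proves that
identification at kernel level, in Mathlib generality (Mathlib's unfolding
`QuotientGroup.integral_mul_eq_integral_automorphize_mul`, specialised to an automorphization equal
to `1`):

* `automorphize_eq_one` : the automorphization of a `Λ`-partition of unity is the constant `1`;
* `integral_mul_eq_integral_quotient` : for a countable subgroup `Λ ≤ T` with fundamental domain `𝓕`
  (for `Λ.op`), a right-invariant measure `ν`, an integrable weight `β` with `∑' a : Λ.op, β (a • t) = 1`,
  and a bounded measurable `g` on `T ⧸ Λ`:
  `∫_T g(π t) β(t) dν = ∫_{T ⧸ Λ} g dν_𝓕`, `ν_𝓕 = map π (ν|𝓕)`;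
* `essSup_enorm_ne_top` : a continuous function on a compact quotient is essentially bounded;
* `betaPeriod_eq_quotientPeriod` : the `β`-weighted toric period equals the genuine period over the
  compact quotient `T ⧸ Λ`: `∫_T β(t) conj χ(t) y(pt t) dν = ∫_{T ⧸ Λ} resy(k) conj ξ(k) dν_𝓕` whenever
  `resy ∘ π = y ∘ pt` and `ξ ∘ π = χ` (a `Λ`-invariant observable `y ∘ pt` and an automorphic
  character `χ`); the weight `wt β (star χ)` is the one of `ToricPseudoEisensteinSeries`.

Provenance: HodgeCM PerL cell `pub-hodgecm`, package file `HodgeCM/Automorphic/TorusUnfold.lean`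
(seat pv15-g2, gate run 25), ported to the tree under the LEAN-IN-TREE rule by seat pv15-g7 (names
`HodgeCM.TorusUnfold.X` ↦ `Literature.NumberTheory.Automorphic.TorusUnfold.X`, statements verbatim).

## References

* A. Deitmar, S. Echterhoff, *Principles of Harmonic Analysis*, 2nd ed. (2014), §1.5, Thm 1.5.3
  (quotient integral formula) [DeitmarEchterhoff2014].
* P. Garrett, *Modern Analysis of Automorphic Forms by Example*, vol. 1 (2018), §5.2 (unwinding)
  [Garrett2018].
-/

noncomputable section

open _root_.MeasureTheory Set Filter Function
open scoped ENNReal ComplexConjugate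

attribute [-instance] Quotient.instMeasurableSpace

namespace Literature.NumberTheory.Automorphic

namespace TorusUnfold

open Literature.NumberTheory.Automorphic.PseudoEisenstein

variable {T : Type*} [Group T] [MeasurableSpace T] [TopologicalSpace T] [IsTopologicalGroup T] [BorelSpace T]
  {ν : Measure T} [ν.IsMulRightInvariant] {Λ : Subgroup T} [Countable Λ]
  [MeasurableSpace (T ⧸ Λ)] [BorelSpace (T ⧸ Λ)]
  {𝓕 : Set T} (h𝓕 : IsFundamentalDomain Λ.op 𝓕 ν)

omit [MeasurableSpace T] [TopologicalSpace T] [IsTopologicalGroup T] [BorelSpace T] [Countable Λ]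
  [MeasurableSpace (T ⧸ Λ)] [BorelSpace (T ⧸ Λ)] in
/-- The automorphization of a `Λ`-partition of unity is the constant `1`. [folklore] -/
theorem automorphize_eq_one (β : T → ℂ) (hβ1 : ∀ t : T, ∑' a : Λ.op, β (a • t) = 1) :
    (QuotientGroup.automorphize β : T ⧸ Λ → ℂ) = 1 := by
  funext q
  induction q using QuotientGroup.induction_on with
  | H t => exact hβ1 t

include h𝓕 in
/-- **β-unfolding**: `∫_T g(π t) β(t) dν = ∫_{T ⧸ Λ} g dν_𝓕` for `β` a `Λ`-partition of unity
(integrable) and `g` bounded measurable on the quotient. [cite: DeitmarEchterhoff2014, Thm 1.5.3] -/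
theorem integral_mul_eq_integral_quotient (β : T → ℂ) (hβi : Integrable β ν)
    (hβ1 : ∀ t : T, ∑' a : Λ.op, β (a • t) = 1)
    (g : T ⧸ Λ → ℂ) (hg : AEStronglyMeasurable g (Measure.map (QuotientGroup.mk : T → T ⧸ Λ) (ν.restrict 𝓕)))
    (hgb : essSup (fun q => (‖g q‖ₑ : ℝ≥0∞)) (Measure.map (QuotientGroup.mk : T → T ⧸ Λ) (ν.restrict 𝓕)) ≠ ∞) :
    ∫ t, g (QuotientGroup.mk t) * β t ∂ν = ∫ q, g q ∂(Measure.map (QuotientGroup.mk : T → T ⧸ Λ) (ν.restrict 𝓕)) := by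
  have h1 : (QuotientGroup.automorphize β : T ⧸ Λ → ℂ) = 1 := automorphize_eq_one β hβ1
  have hF : AEStronglyMeasurable (QuotientGroup.automorphize β)
      (Measure.map (QuotientGroup.mk : T → T ⧸ Λ) (ν.restrict 𝓕)) := by
    rw [h1]
    exact aestronglyMeasurable_const
  rw [QuotientGroup.integral_mul_eq_integral_automorphize_mul h𝓕 hβi hg hgb hF]
  simp only [h1, Pi.one_apply, mul_one]

omit [MeasurableSpace T] [IsTopologicalGroup T] [BorelSpace T] [Countable Λ] [BorelSpace (T ⧸ Λ)] in
/-- A continuous function on a compact quotient is essentially bounded for any measure. [folklore] -/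
theorem essSup_enorm_ne_top [CompactSpace (T ⧸ Λ)] (μ : Measure (T ⧸ Λ)) (g : C(T ⧸ Λ, ℂ)) :
    essSup (fun q => (‖g q‖ₑ : ℝ≥0∞)) μ ≠ ∞ := by
  refine ne_top_of_le_ne_top ENNReal.coe_ne_top (essSup_le_of_ae_le (‖g‖₊ : ℝ≥0∞) (Eventually.of_forall fun q => ?_))
  have h : ‖g q‖ ≤ ‖g‖ := g.norm_coe_le_norm q
  change ‖g q‖ₑ ≤ (‖g‖₊ : ℝ≥0∞)
  rw [enorm_eq_nnnorm]
  exact_mod_cast h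

include h𝓕 in
/-- **The β-weighted toric period IS the period over the compact quotient**: for `β` real,
continuous, compactly supported with `∑' a : Λ.op, β (a • t) = 1`, `χ` continuous, `pt : T → Q`,
`y : Q → ℂ`, and any `resy`, `ξ` on the compact quotient `T ⧸ Λ` with `resy (π t) = y (pt t)`,
`ξ (π t) = χ t` (continuous): `∫_T β(t) conj χ(t) y(pt t) dν = ∫_{T ⧸ Λ} resy(k) conj ξ(k) dν_𝓕`.
[cite: DeitmarEchterhoff2014, Thm 1.5.3] -/
theorem betaPeriod_eq_quotientPeriod [CompactSpace (T ⧸ Λ)]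
    (β : T → ℝ) (hβ : Continuous β) (hβs : HasCompactSupport β) [IsFiniteMeasureOnCompacts ν]
    (hβ1 : ∀ t : T, ∑' a : Λ.op, (β (a • t) : ℂ) = 1)
    (χ : T → ℂ) {Q : Type*} (pt : T → Q) (y : Q → ℂ)
    (resy : C(T ⧸ Λ, ℂ)) (hres : ∀ t, resy (QuotientGroup.mk t) = y (pt t))
    (ξ : C(T ⧸ Λ, ℂ)) (hξ : ∀ t, ξ (QuotientGroup.mk t) = χ t) :
    ∫ t, wt β (star χ) t * y (pt t) ∂ν
      = ∫ k, resy k * conj (ξ k) ∂(Measure.map (QuotientGroup.mk : T → T ⧸ Λ) (ν.restrict 𝓕)) := by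
  -- the bounded measurable observable `g := resy · conj ξ` on the quotient
  set g : C(T ⧸ Λ, ℂ) := resy * (ContinuousMap.mk (fun k => conj (ξ k))
    (Complex.continuous_conj.comp ξ.continuous)) with hg
  have hgq : ∀ k, g k = resy k * conj (ξ k) := fun k => rfl
  have key := integral_mul_eq_integral_quotient h𝓕 (fun t => (β t : ℂ))
    ((Complex.continuous_ofReal.comp hβ).integrable_of_hasCompactSupport
      (hβs.comp_left Complex.ofReal_zero)) hβ1 g
    g.continuous.aestronglyMeasurable (essSup_enorm_ne_top _ g)
  simp only [hgq] at key
  rw [← key]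
  congr 1
  ext t
  rw [hres, hξ, wt, Pi.star_apply, Complex.star_def]
  ring


end TorusUnfold

end Literature.NumberTheory.Automorphic

end
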